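import Summits.CriticalPhenomena.CardyFormulaZ2.Theorems.CardyMagicRigidityNestingRigidityNeckNodeReimerT
import HarnessLib

/-!
# Crux `NestingRigidity`, line `pinch-resampling` (v4), stub S11: the Reimer glue on `𝕋` with arms and distinctness INSIDE A REGION

Crux `Summit.CriticalPhenomena.CardyFormulaZ2.Theses.CardyMagicRigidity.NestingRigidity` (stmt-CriticalPhenomena-4835),
line `pinch-resampling` v4, stub S11 `stub_neckHookupCoarseT : NeckHookupCoarseT`.  Worker W6c, wave 6: the site-`𝕋` twin of
`…NeckZ2NodeReimerRegion` (worker W6a, wave 6), sequel of `…NeckNodeReimerT`.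

In the necklace `TNodeEventChainA` (`…NeckErrorCoverT`) the open clusters met along the ranks are pairwise distinct INSIDE
`Λ_{2s}(x)` only (the two end clusters may be joined outside the big ball), so the glue consumed by the summation must read
arms and distinctness inside a region `S` (there `S = tBall x (2 * s)`), with the node annuli inside `S`.  This module proves
that form, with both exemptions of `…NeckNodeReimerT` and, in addition, a pairwise ARM–ARM spatial exemption (two arms need
not lie in distinct clusters if their annuli are disjoint):

* §1 `NeckCoarse.mem_tFourArm_disjointOccurrence_armsIn` (deterministic core, region form).
* §2 `real_tFourArm_and_armsIn_le` (registered anchor): GIVEN (I4T) `FourArmTwoClustersBoundT`, the probability is at most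
  `(∏ c (r a / R a)^{1+ε}) · ∏ C (r' i / R' i)^α`.
-/

noncomputable section

namespace Summit.CriticalPhenomena.CardyFormulaZ2.Cruxes.NestingRigidity.PinchResampling

open MeasureTheory Set Literature.Probability.Percolation Literature.Probability.LatticeModels

namespace NeckCoarse

variable {ω : SiteConfig (Site 2)}

/-! ## §1 The deterministic core, region form -/

/-- **Disjoint occurrence of the four-arm events and the arm events, region form**: node annuli inside `S`, arms and
distinctness of clusters read inside `S`; arm–arm and arm–node pairs are separated by cluster (inside `S`) or by space. -/
theorem mem_tFourArm_disjointOccurrence_armsIn (S : Set (Site 2)) {ι κ : Type*} (t : Finset ι) (w : ι → Site 2)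
    (r R : ι → ℕ) (hS : ∀ a ∈ t, tAnn (w a) (r a) (R a) ⊆ S)
    (l : List κ) (hl : l.Nodup) (w' : κ → Site 2) (r' R' : κ → ℕ) (hrR' : ∀ i ∈ l, r' i < R' i)
    (p₁ q₁ p₂ q₂ : ι → Site 2) (c : κ → Site 2)
    (h4a : ∀ a ∈ t, triNorm (p₁ a - w a) = r a ∧ triNorm (q₁ a - w a) = R a ∧ triNorm (p₂ a - w a) = r a ∧
      triNorm (q₂ a - w a) = R a ∧ PathIn (tColourGraph ω true) (tAnn (w a) (r a) (R a)) (p₁ a) (q₁ a) ∧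
      PathIn (tColourGraph ω true) (tAnn (w a) (r a) (R a)) (p₂ a) (q₂ a) ∧
      ¬ PathIn (tColourGraph ω true) (tAnn (w a) (r a) (R a)) (p₁ a) (p₂ a))
    (harm : ∀ i ∈ l, triNorm (c i - w' i) < r' i ∧ ∃ q, (R' i : ℤ) ≤ triNorm (q - w' i) ∧
      PathIn (tColourGraph ω true) S (c i) q)
    (hdist : ∀ i ∈ l, ∀ j ∈ l, i ≠ j → ¬ PathIn (tColourGraph ω true) S (c i) (c j) ∨
      Disjoint (tAnn (w' i) (r' i) (R' i)) (tAnn (w' j) (r' j) (R' j)))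
    (havoid : ∀ i ∈ l, ∀ a ∈ t, (¬ PathIn (tColourGraph ω true) S (c i) (p₁ a) ∧
        ¬ PathIn (tColourGraph ω true) S (c i) (p₂ a)) ∨
      Disjoint (tAnn (w' i) (r' i) (R' i)) (tAnn (w a) (r a) (R a))) :
    ω ∈ (⋂ a ∈ t, TFourArmTwoClusters (w a) (r a) (R a)) □
      disjointOccurrenceList (l.map fun i ↦ {ω : SiteConfig (Site 2) | ∃ p q : Site 2, triNorm (p - w' i) = r' i ∧
        triNorm (q - w' i) = R' i ∧ PathIn (tColourGraph ω true) (tAnn (w' i) (r' i) (R' i)) p q}) := by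
  classical
  -- adapted from `NeckCoarse.mem_tFourArm_disjointOccurrence_arms` (`…NeckNodeReimerT`): supports inside `S`
  have key : ∀ i ∈ l, ∃ K : Set (Site 2), K ⊆ ω ∧
      K ∈ {ω : SiteConfig (Site 2) | ∃ p q : Site 2, triNorm (p - w' i) = r' i ∧ triNorm (q - w' i) = R' i ∧
        PathIn (tColourGraph ω true) (tAnn (w' i) (r' i) (R' i)) p q} ∧
      ∀ z ∈ K, PathIn (tColourGraph ω true) S (c i) z ∧ z ∈ tAnn (w' i) (r' i) (R' i) := by
    intro i hi
    obtain ⟨hnear, q, hqR, hpath⟩ := harm i hi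
    have hne : c i ≠ q := by
      rintro h
      have := hrR' i hi; rw [← h] at hqR; omega
    have hcω : c i ∈ ω := by rw [tColourGraph_true] at hpath; exact NeckCoarse.mem_of_pathIn_ne hpath hne
    obtain ⟨S', hS', hP, hSt⟩ := (NeckCoarse.pathIn_inter_of_pathIn_open hpath hcω).exists_support
    obtain ⟨p, q', hp, hq', hcross⟩ := hP.exists_annulus_arm hnear.le hqR (hrR' i hi)
    obtain ⟨T, hT, hPT, -⟩ := hcross.exists_support
    refine ⟨T, fun z hz ↦ (hS' (hT hz).1).2, ⟨p, q', hp, hq', ?_⟩, fun z hz ↦ ⟨?_, (hT hz).2⟩⟩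
    · exact NeckCoarse.pathIn_open_of_pathIn_inter (hPT.mono fun z hz ↦ ⟨(hT hz).2, hz⟩)
    · exact NeckCoarse.pathIn_open_of_pathIn_inter ((hSt z (hT hz).1).mono hS')
  choose! K hKω hKA hKc using key
  set K₀ : Set (Site 2) := ⋃ a ∈ t, ({z | PathIn (tColourGraph ω true) (tAnn (w a) (r a) (R a)) (p₁ a) z} ∪
    {z | PathIn (tColourGraph ω true) (tAnn (w a) (r a) (R a)) (p₂ a) z} ∪ (tAnn (w a) (r a) (R a) \ ω)) with hK₀
  have hcyl : localCylinder K₀ ω ⊆ ⋂ a ∈ t, TFourArmTwoClusters (w a) (r a) (R a) := by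
    intro ω' hω'
    refine mem_iInter₂.2 fun a ha ↦ ?_
    obtain ⟨hp₁, hq₁, hp₂, hq₂, hP₁, hP₂, hn⟩ := h4a a ha
    exact localCylinder_subset_tFourArm hp₁ hq₁ hp₂ hq₂ hP₁ hP₂ hn fun z hz ↦ hω' z (mem_biUnion ha hz)
  have hmem := mem_inter_disjointOccurrenceList_of_witnesses hcyl
    (l.map fun i ↦ ({ω : SiteConfig (Site 2) | ∃ p q : Site 2, triNorm (p - w' i) = r' i ∧ triNorm (q - w' i) = R' i ∧
      PathIn (tColourGraph ω true) (tAnn (w' i) (r' i) (R' i)) p q}, K i))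
    (fun q hq ↦ by
      obtain ⟨i, -, rfl⟩ := List.mem_map.1 hq
      exact isUpperSet_tOneArm _ _ _)
    (fun q hq ↦ by
      obtain ⟨i, hi, rfl⟩ := List.mem_map.1 hq
      exact hKA i hi)
    (fun q hq ↦ by
      obtain ⟨i, hi, rfl⟩ := List.mem_map.1 hq
      exact hKω i hi)
    ?_ ?_
  · simpa only [List.map_map, Function.comp_def] using hmem
  · -- arm witnesses are pairwise disjoint: distinct clusters inside `S`, or disjoint annuli
    rw [List.pairwise_map]
    refine hl.pairwise_of_forall_ne fun i hi j hj hij ↦ ?_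
    rw [Set.disjoint_left]
    intro z hzi hzj
    rcases hdist i hi j hj hij with hcl | hsp
    · exact hcl ((hKc i hi z hzi).1.trans (hKc j hj z hzj).1.symm)
    · exact Set.disjoint_left.1 hsp (hKc i hi z hzi).2 (hKc j hj z hzj).2
  · -- arm witnesses avoid the cylinder
    intro q hq
    obtain ⟨i, hi, rfl⟩ := List.mem_map.1 hq
    rw [hK₀, Set.disjoint_iUnion₂_left]
    intro a ha
    rw [Set.disjoint_left]
    rcases havoid i hi a ha with hcl | hsp
    · rintro z (⟨hz | hz⟩ | hz) hzK
      · exact hcl.1 ((hKc i hi z hzK).1.trans ((PathIn.symm hz).mono (hS a ha)))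
      · exact hcl.2 ((hKc i hi z hzK).1.trans ((PathIn.symm hz).mono (hS a ha)))
      · exact hz.2 (hKω i hi hzK)
    · intro z hz hzK
      have hz' : z ∈ tAnn (w a) (r a) (R a) := by
        rcases hz with (hz | hz) | hz
        · exact PathIn.right_mem hz
        · exact PathIn.right_mem hz
        · exact hz.1
      exact Set.disjoint_left.1 hsp (hKc i hi z hzK).2 hz'

end NeckCoarse

/-! ## §2 The glued bound, region form -/

/-- **Four-arm node events over disjoint annuli AND arms of clusters distinct inside a region, with spatial exemptions
(registered helper, anchor of this module on the crux item).**  GIVEN (I4T) `FourArmTwoClustersBoundT`, there are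
`c, ε, C, α` (`ε, C, α > 0`) such that for every region `S`, pairwise disjoint hexagonal annuli `tAnn (w a) (r a) (R a) ⊆ S`
(`1 ≤ r a ≤ R a`) each carrying two open crossings not joined inside the annulus, and points `c i` (`|c i - w' i|_𝕋 < r' i`,
`1 ≤ r' i < R' i`) joined INSIDE `S` by open paths to `𝕋`-distance `≥ R' i` from `w' i`, every two arms lying in clusters
distinct inside `S` OR having disjoint annuli, and every arm, for every node, lying in a cluster (inside `S`) avoiding the
node's two crossing starts OR having its annulus disjoint from the node's, the probability is at most
`(∏ c (r a / R a)^{1+ε}) · ∏ C (r' i / R' i)^α`. -/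
theorem real_tFourArm_and_armsIn_le : FourArmTwoClustersBoundT → ∃ c ε C α : ℝ, 0 < ε ∧ 0 < C ∧ 0 < α ∧ ∀ (S : Set (Site 2)) (ι κ : Type) (t : Finset ι) (w : ι → Site 2) (r R : ι → ℕ) (u : Finset κ) (w' : κ → Site 2) (r' R' : κ → ℕ), (∀ a ∈ t, 1 ≤ r a ∧ r a ≤ R a) → (∀ a ∈ t, tAnn (w a) (r a) (R a) ⊆ S) → (↑t : Set ι).PairwiseDisjoint (fun a ↦ tAnn (w a) (r a) (R a)) → (∀ i ∈ u, 1 ≤ r' i ∧ r' i < R' i) → (triSitePercolation half).real {ω | ∃ (p₁ q₁ p₂ q₂ : ι → Site 2) (c : κ → Site 2), (∀ a ∈ t, triNorm (p₁ a - w a) = r a ∧ triNorm (q₁ a - w a) = R a ∧ triNorm (p₂ a - w a) = r a ∧ triNorm (q₂ a - w a) = R a ∧ PathIn (tColourGraph ω true) (tAnn (w a) (r a) (R a)) (p₁ a) (q₁ a) ∧ PathIn (tColourGraph ω true) (tAnn (w a) (r a) (R a)) (p₂ a) (q₂ a) ∧ ¬ PathIn (tColourGraph ω true) (tAnn (w a)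 (r a) (R a)) (p₁ a) (p₂ a)) ∧ (∀ i ∈ u, triNorm (c i - w' i) < r' i ∧ ∃ q, (R' i : ℤ) ≤ triNorm (q - w' i) ∧ PathIn (tColourGraph ω true) S (c i) q) ∧ (∀ i ∈ u, ∀ j ∈ u, i ≠ j → ¬ PathIn (tColourGraph ω true) S (c i) (c j) ∨ Disjoint (tAnn (w' i) (r' i) (R' i)) (tAnn (w' j) (r' j) (R' j))) ∧ (∀ i ∈ u, ∀ a ∈ t, (¬ PathIn (tColourGraph ω true) S (c i) (p₁ a) ∧ ¬ PathIn (tColourGraph ω true) S (c i) (p₂ a)) ∨ Disjoint (tAnn (w' i) (r' i) (R' i)) (tAnn (w a) (r a) (R a)))} ≤ (∏ a ∈ t, c * ((r a : ℝ) / R a) ^ (1 + ε)) * ∏ i ∈ u, C * ((r' i : ℝ) / (R' i : ℝ)) ^ α := by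
  intro h4T
  obtain ⟨c, ε, hε, h4⟩ := real_biInter_tFourArmTwoClusters_le_prod_rpow h4T
  obtain ⟨C, α, hC, hα, h1⟩ := NeckCoarse.real_tOneArm_le
  refine ⟨c, ε, C, α, hε, hC, hα, fun S ι κ t w r R u w' r' R' hrR hS hdisj hrR' ↦ ?_⟩
  classical
  -- adapted from `real_tFourArm_and_arms_le` (`…NeckNodeReimerT`)
  obtain ⟨E, hE⟩ : ∃ E : Set (SiteConfig (Site 2)), E = {ω | ∃ (p₁ q₁ p₂ q₂ : ι → Site 2) (c : κ → Site 2),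
      (∀ a ∈ t, triNorm (p₁ a - w a) = r a ∧ triNorm (q₁ a - w a) = R a ∧ triNorm (p₂ a - w a) = r a ∧
        triNorm (q₂ a - w a) = R a ∧ PathIn (tColourGraph ω true) (tAnn (w a) (r a) (R a)) (p₁ a) (q₁ a) ∧
        PathIn (tColourGraph ω true) (tAnn (w a) (r a) (R a)) (p₂ a) (q₂ a) ∧
        ¬ PathIn (tColourGraph ω true) (tAnn (w a) (r a) (R a)) (p₁ a) (p₂ a)) ∧
      (∀ i ∈ u, triNorm (c i - w' i) < r' i ∧ ∃ q, (R' i : ℤ) ≤ triNorm (q - w' i) ∧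
        PathIn (tColourGraph ω true) S (c i) q) ∧
      (∀ i ∈ u, ∀ j ∈ u, i ≠ j → ¬ PathIn (tColourGraph ω true) S (c i) (c j) ∨
        Disjoint (tAnn (w' i) (r' i) (R' i)) (tAnn (w' j) (r' j) (R' j))) ∧
      (∀ i ∈ u, ∀ a ∈ t, (¬ PathIn (tColourGraph ω true) S (c i) (p₁ a) ∧
        ¬ PathIn (tColourGraph ω true) S (c i) (p₂ a)) ∨
        Disjoint (tAnn (w' i) (r' i) (R' i)) (tAnn (w a) (r a) (R a)))} := ⟨_, rfl⟩
  rw [← hE]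
  set μ := triSitePercolation half with hμ
  set Arm : κ → Set (SiteConfig (Site 2)) := fun i ↦ {ω : SiteConfig (Site 2) | ∃ p q : Site 2,
    triNorm (p - w' i) = r' i ∧ triNorm (q - w' i) = R' i ∧
    PathIn (tColourGraph ω true) (tAnn (w' i) (r' i) (R' i)) p q} with hArm
  set L := u.toList.map Arm with hL
  set A := ⋂ a ∈ t, TFourArmTwoClusters (w a) (r a) (R a) with hA
  have hcover : E ⊆ A □ disjointOccurrenceList L := by
    intro ω hω
    rw [hE] at hω
    obtain ⟨p₁, q₁, p₂, q₂, cc, h4a, harm, hdist, havoid⟩ := hω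
    have h := NeckCoarse.mem_tFourArm_disjointOccurrence_armsIn S t w r R hS u.toList (Finset.nodup_toList u) w' r' R'
      (fun i hi ↦ (hrR' i (Finset.mem_toList.1 hi)).2) p₁ q₁ p₂ q₂ cc h4a
      (fun i hi ↦ harm i (Finset.mem_toList.1 hi))
      (fun i hi j hj hij ↦ hdist i (Finset.mem_toList.1 hi) j (Finset.mem_toList.1 hj) hij)
      fun i hi a ha ↦ havoid i (Finset.mem_toList.1 hi) a ha
    simpa only [hA, hL, hArm] using h
  have hup : ∀ D ∈ L, IsUpperSet D := fun D hD ↦ by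
    obtain ⟨i, -, rfl⟩ := List.mem_map.1 hD
    exact NeckCoarse.isUpperSet_tOneArm _ _ _
  set F : Finset (Site 2) := (t.biUnion fun a ↦ (finite_tAnnulus (w a) (r a) (R a)).toFinset) ∪
    u.biUnion fun i ↦ (finite_tAnnulus (w' i) (r' i) (R' i)).toFinset with hF
  have hdetL : ∀ D ∈ L, DeterminedBy D ↑F := fun D hD ↦ by
    obtain ⟨i, hi, rfl⟩ := List.mem_map.1 hD
    refine (NeckCoarse.determinedBy_tOneArm (w' i) (r' i) (R' i)).mono fun y hy ↦ ?_
    rw [hF, Finset.coe_union, Finset.coe_biUnion, Finset.coe_biUnion]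
    exact Or.inr (mem_biUnion (Finset.mem_coe.2 (Finset.mem_toList.1 hi)) (by simpa using hy))
  have hdetA : DeterminedBy A ↑F := by
    refine (NeckCoarse.determinedBy_biInter_tFourArmTwoClusters t w r R).mono fun y hy ↦ ?_
    rw [hF, Finset.coe_union, Finset.coe_biUnion, Finset.coe_biUnion]
    simp only [mem_iUnion, exists_prop] at hy
    obtain ⟨a, ha, hya⟩ := hy
    exact Or.inl (mem_biUnion (Finset.mem_coe.2 ha) (by simpa using hya))
  have hdetB : DeterminedBy (disjointOccurrenceList L) ↑F := NeckCoarse.determinedBy_disjointOccurrenceList L hup hdetL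
  have hreimer : μ.real (A □ disjointOccurrenceList L) ≤ μ.real A * μ.real (disjointOccurrenceList L) :=
    sitePercolation_reimer half hdetA hdetB
  have hprod : (L.map μ.real).prod = ∏ i ∈ u, μ.real (Arm i) := by
    rw [hL, List.map_map, Function.comp_def, Finset.prod_map_toList]
  have hA4 : μ.real A ≤ ∏ a ∈ t, c * ((r a : ℝ) / R a) ^ (1 + ε) := h4 ι t w r R hrR hdisj
  have hB : μ.real (disjointOccurrenceList L) ≤ ∏ i ∈ u, C * ((r' i : ℝ) / (R' i : ℝ)) ^ α := by
    calc μ.real (disjointOccurrenceList L) ≤ (L.map μ.real).prod := NeckCoarse.sitePercolation_bk_list half L hup hdetL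
      _ = ∏ i ∈ u, μ.real (Arm i) := hprod
      _ ≤ ∏ i ∈ u, C * ((r' i : ℝ) / (R' i : ℝ)) ^ α :=
          Finset.prod_le_prod (fun i _ ↦ measureReal_nonneg) fun i hi ↦ h1 (w' i) (r' i) (R' i) (hrR' i hi).1 (hrR' i hi).2
  calc μ.real E ≤ μ.real (A □ disjointOccurrenceList L) := measureReal_mono hcover (measure_ne_top _ _)
    _ ≤ μ.real A * μ.real (disjointOccurrenceList L) := hreimer
    _ ≤ (∏ a ∈ t, c * ((r a : ℝ) / R a) ^ (1 + ε)) * ∏ i ∈ u, C * ((r' i : ℝ) / (R' i : ℝ)) ^ α :=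
        mul_le_mul hA4 hB measureReal_nonneg (le_trans measureReal_nonneg hA4)

end Summit.CriticalPhenomena.CardyFormulaZ2.Cruxes.NestingRigidity.PinchResampling

end
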